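import Mathlib
import Summits.ValiantsHypothesis.ValiantsHypothesis.Theorems.RigidityForcesSymmetryRankRigidMinimalReprLaplaceFiveStarWedge

/-!
# ValiantsHypothesis / RigidityForcesSymmetry — crux `LaplaceOptimalFive` (stmt-ValiantsHypothesis-24813), crux idea
`young-shadow` (K1) on the star: **FROM THE EXCHANGE IDENTITY TO `dk ∧ dq₁ ∧ dq₂ = 0` IN `MvPolynomial (Fin 5) ℂ`** (memo §14, price L2)

The referee's LEMMA K (`NOTE-crit3g5-24813-Lemma2prime-elementary.md` §B; memo `NOTE-p4g15-24813-K1-star.md` §12/§14) is a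
statement about a cubic `k` and two quadrics `q₁, q₂` in the polynomial ring `R = ℂ[y₀,…,y₄]` with `dk ∧ dq₁ ∧ dq₂ = 0`.  This file
is the BRIDGE from the letter tensors of a two-term star shadow to that hypothesis in `R := MvPolynomial (Fin 5) ℂ`:
with `Q_i := Σ_{a,b} C(U_i a b)·X a·X b` and `K := Σ_{a,b,c} C(W₁ a b c)·X a·X b·X c`,

* `pderiv_quadric`, `pderiv_cubic`, `eval_pderiv_quadric`, `eval_pderiv_cubic` — the calculus (`∂_c Q = 2·Σ_d U c d X d`, …);
* `wedge_minors_poly` — the `3 × 3` minors of the Jacobian `[∂K | ∂Q₁ | ∂Q₂]` VANISH IN `R`, from the exchange identity `(C_H)` of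
  `H = U₁⊗W₁ + U₂⊗W₂` (✓ `wedge_minors_of_exchange` pointwise, then `MvPolynomial.funext`);
* `cramer_consistency` — Grassmann–Plücker: vanishing `3 × 3` minors ⟹ `(k∧q)_{ac}(p∧q)_{bd} = (k∧q)_{bd}(p∧q)_{ac}` in any
  commutative ring (the well-definedness of `α = N_{ac}/M_{ac}` in LEMMA K);
* (r3) `quadric_isHomogeneous`, `cubic_isHomogeneous`, `euler_quadric`, `euler_cubic` — degrees and Euler's identity.

Pure algebra; no star hypotheses; no definitions, no `sorry`.  Honest framing: helper toward the Lean price (L2) of the K1-on-the-star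
theorem (PAPER, referee PASS; not kernel); `LaplaceOptimalFive` OPEN · CONTESTED 72/120; `VP ≠ VNP` NOT proved.
-/

set_option linter.dupNamespace false

namespace Summit.ValiantsHypothesis.ValiantsHypothesis.Theorems.RigidityForcesSymmetryRankRigidMinimalRepr

namespace LaplaceFiveStar

open Finset MvPolynomial

/-- `∂_c (Σ_{a,b} U_{ab} X_a X_b) = Σ_b (U_{cb} + U_{bc}) X_b`. [folklore] -/
theorem pderiv_quadric (U : Fin 5 → Fin 5 → ℂ) (c : Fin 5) :
    pderiv c (∑ a : Fin 5, ∑ b : Fin 5, C (U a b) * X a * X b : MvPolynomial (Fin 5) ℂ)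
      = ∑ b : Fin 5, C (U c b + U b c) * X b := by
  simp only [map_sum, Derivation.leibniz, pderiv_C, pderiv_X, smul_eq_mul, mul_zero, add_zero]
  simp only [Pi.single_apply, mul_ite, mul_one, mul_zero, Finset.sum_add_distrib, Finset.sum_ite_eq',
    Finset.mem_univ, if_true]
  rw [Finset.sum_comm]
  simp only [Finset.sum_ite_eq', Finset.mem_univ, if_true, map_add, add_mul]
  rw [← Finset.sum_add_distrib]
  refine Finset.sum_congr rfl fun b _ => ?_
  ring

/-- `∂_d (Σ_{a,b,c} W_{abc} X_a X_b X_c) = Σ_{b,c} (W_{dbc} + W_{bdc} + W_{bcd}) X_b X_c`. [folklore] -/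
theorem pderiv_cubic (W : Fin 5 → Fin 5 → Fin 5 → ℂ) (d : Fin 5) :
    pderiv d (∑ a : Fin 5, ∑ b : Fin 5, ∑ c : Fin 5, C (W a b c) * X a * X b * X c : MvPolynomial (Fin 5) ℂ)
      = ∑ b : Fin 5, ∑ c : Fin 5, C (W d b c + W b d c + W b c d) * X b * X c := by
  simp only [map_sum, Derivation.leibniz, pderiv_C, pderiv_X, smul_eq_mul, mul_zero, add_zero]
  simp only [Pi.single_apply, mul_ite, mul_one, mul_zero, Finset.sum_add_distrib, Finset.sum_ite_eq',
    Finset.mem_univ, if_true, mul_add]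
  have t2 : (∑ x : Fin 5, ∑ x_1 : Fin 5, ∑ x_2 : Fin 5,
      (if x_1 = d then X x_2 * (C (W x x_1 x_2) * X x) else 0) : MvPolynomial (Fin 5) ℂ)
      = ∑ x : Fin 5, ∑ x_2 : Fin 5, X x_2 * (C (W x d x_2) * X x) := by
    refine Finset.sum_congr rfl fun x _ => ?_
    rw [Finset.sum_comm]
    refine Finset.sum_congr rfl fun x_2 _ => ?_
    simp only [Finset.sum_ite_eq', Finset.mem_univ, if_true]
  have t3 : (∑ x : Fin 5, ∑ x_1 : Fin 5, ∑ x_2 : Fin 5,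
      (if x = d then X x_2 * (X x_1 * C (W x x_1 x_2)) else 0) : MvPolynomial (Fin 5) ℂ)
      = ∑ x_1 : Fin 5, ∑ x_2 : Fin 5, X x_2 * (X x_1 * C (W d x_1 x_2)) := by
    rw [Finset.sum_comm]
    refine Finset.sum_congr rfl fun x_1 _ => ?_
    rw [Finset.sum_comm]
    refine Finset.sum_congr rfl fun x_2 _ => ?_
    simp only [Finset.sum_ite_eq', Finset.mem_univ, if_true]
  rw [t2, t3]
  simp only [map_add, add_mul, Finset.sum_add_distrib]
  have e2 : (∑ x : Fin 5, ∑ x_2 : Fin 5, X x_2 * (C (W x d x_2) * X x) : MvPolynomial (Fin 5) ℂ)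
      = ∑ b : Fin 5, ∑ c : Fin 5, C (W b d c) * X b * X c := by
    refine Finset.sum_congr rfl fun b _ => Finset.sum_congr rfl fun c _ => ?_
    ring
  have e3 : (∑ x_1 : Fin 5, ∑ x_2 : Fin 5, X x_2 * (X x_1 * C (W d x_1 x_2)) : MvPolynomial (Fin 5) ℂ)
      = ∑ b : Fin 5, ∑ c : Fin 5, C (W d b c) * X b * X c := by
    refine Finset.sum_congr rfl fun b _ => Finset.sum_congr rfl fun c _ => ?_
    ring
  rw [e2, e3]
  abel

/-- Evaluation of `∂_c Q` for a SYMMETRIC `U`: `(∂_c Q)(y) = 2·Σ_d U c d · y d`. [folklore] -/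
theorem eval_pderiv_quadric (U : Fin 5 → Fin 5 → ℂ) (hU : ∀ a b : Fin 5, U a b = U b a) (y : Fin 5 → ℂ) (c : Fin 5) :
    MvPolynomial.eval y (pderiv c (∑ a : Fin 5, ∑ b : Fin 5, C (U a b) * X a * X b : MvPolynomial (Fin 5) ℂ))
      = 2 * ∑ d : Fin 5, U c d * y d := by
  rw [pderiv_quadric]
  simp only [map_sum, map_mul, eval_C, eval_X]
  rw [Finset.mul_sum]
  refine Finset.sum_congr rfl fun d _ => ?_
  rw [hU d c]
  ring

/-- Evaluation of `∂_d K` for a SYMMETRIC `W`: `(∂_d K)(y) = 3·Σ_{e,f} W d e f · y e · y f`. [folklore] -/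
theorem eval_pderiv_cubic (W : Fin 5 → Fin 5 → Fin 5 → ℂ) (hWa : ∀ a b c : Fin 5, W a b c = W b a c)
    (hWb : ∀ a b c : Fin 5, W a b c = W a c b) (y : Fin 5 → ℂ) (d : Fin 5) :
    MvPolynomial.eval y
        (pderiv d (∑ a : Fin 5, ∑ b : Fin 5, ∑ c : Fin 5, C (W a b c) * X a * X b * X c : MvPolynomial (Fin 5) ℂ))
      = 3 * ∑ e : Fin 5, ∑ f : Fin 5, W d e f * y e * y f := by
  rw [pderiv_cubic]
  simp only [map_sum, map_mul, eval_C, eval_X]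
  rw [Finset.mul_sum]
  refine Finset.sum_congr rfl fun e _ => ?_
  rw [Finset.mul_sum]
  refine Finset.sum_congr rfl fun f _ => ?_
  have h1 : W e d f = W d e f := hWa e d f
  have h2 : W e f d = W d e f := by rw [hWb e f d, hWa e d f]
  rw [h1, h2]
  ring

/-- **`dk₁ ∧ dq₁ ∧ dq₂ = 0` in `MvPolynomial (Fin 5) ℂ`** for a closed two-term letter tensor: every `3 × 3` minor of the Jacobian
`[∂K | ∂Q₁ | ∂Q₂]` vanishes as a POLYNOMIAL — the hypothesis of LEMMA K — from the exchange identity `(C_H)`. [folklore] -/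
theorem wedge_minors_poly (U₁ U₂ : Fin 5 → Fin 5 → ℂ) (W₁ W₂ : Fin 5 → Fin 5 → Fin 5 → ℂ)
    (hU1 : ∀ a b : Fin 5, U₁ a b = U₁ b a) (hU2 : ∀ a b : Fin 5, U₂ a b = U₂ b a)
    (hW1a : ∀ a b c : Fin 5, W₁ a b c = W₁ b a c) (hW1b : ∀ a b c : Fin 5, W₁ a b c = W₁ a c b)
    (hW2b : ∀ a b c : Fin 5, W₂ a b c = W₂ a c b)
    (hC : ∀ A B C D E : Fin 5,
      (U₁ A C * W₁ B D E + U₁ A D * W₁ B C E + U₁ A E * W₁ B C D)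
        + (U₂ A C * W₂ B D E + U₂ A D * W₂ B C E + U₂ A E * W₂ B C D)
      = (U₁ B C * W₁ A D E + U₁ B D * W₁ A C E + U₁ B E * W₁ A C D)
        + (U₂ B C * W₂ A D E + U₂ B D * W₂ A C E + U₂ B E * W₂ A C D))
    (a b c : Fin 5) :
    let Q₁ : MvPolynomial (Fin 5) ℂ := ∑ i : Fin 5, ∑ j : Fin 5, C (U₁ i j) * X i * X j
    let Q₂ : MvPolynomial (Fin 5) ℂ := ∑ i : Fin 5, ∑ j : Fin 5, C (U₂ i j) * X i * X j
    let K : MvPolynomial (Fin 5) ℂ := ∑ i : Fin 5, ∑ j : Fin 5, ∑ l : Fin 5, C (W₁ i j l) * X i * X j * X l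
    pderiv a K * (pderiv b Q₁ * pderiv c Q₂ - pderiv c Q₁ * pderiv b Q₂)
      - pderiv b K * (pderiv a Q₁ * pderiv c Q₂ - pderiv c Q₁ * pderiv a Q₂)
      + pderiv c K * (pderiv a Q₁ * pderiv b Q₂ - pderiv b Q₁ * pderiv a Q₂) = 0 := by
  intro Q₁ Q₂ K
  apply MvPolynomial.funext
  intro y
  simp only [map_sub, map_add, map_mul, map_zero]
  simp only [Q₁, Q₂, K, eval_pderiv_quadric U₁ hU1, eval_pderiv_quadric U₂ hU2, eval_pderiv_cubic W₁ hW1a hW1b]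
  have h := wedge_minors_of_exchange U₁ U₂ W₁ W₂ hW1b hW2b hC y a b c
  simp only at h
  linear_combination (12 : ℂ) * h

/-- **Cramer consistency (Grassmann–Plücker).**  Over any commutative ring: if all `3 × 3` minors of `[k | p | q]` vanish then the
`2 × 2` minors `N = k ∧ q` and `M = p ∧ q` satisfy `N_{ac} M_{bd} = N_{bd} M_{ac}` — i.e. the ratio `α = N_{ac}/M_{ac}` of LEMMA K
(`dk = α dq₁ + β dq₂`) does not depend on `(a,c)`.  Identity: `N_{ac}M_{bd} − N_{bd}M_{ac} = q_c·T_{abd} + q_a·T_{cdb}`. [folklore] -/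
theorem cramer_consistency {R : Type*} [CommRing R] (k p q : Fin 5 → R)
    (hT : ∀ u v w : Fin 5, k u * (p v * q w - p w * q v) - k v * (p u * q w - p w * q u) + k w * (p u * q v - p v * q u) = 0)
    (a b c d : Fin 5) :
    (k a * q c - k c * q a) * (p b * q d - p d * q b) = (k b * q d - k d * q b) * (p a * q c - p c * q a) := by
  linear_combination q c * hT a b d + q a * hT c d b

/-! ### Homogeneity and Euler (appended r3): the degree bookkeeping LEMMA K uses in every case. -/

/-- The quadric `Σ C(U a b) X_a X_b` is homogeneous of degree 2. [folklore] -/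
theorem quadric_isHomogeneous (U : Fin 5 → Fin 5 → ℂ) :
    (∑ a : Fin 5, ∑ b : Fin 5, C (U a b) * X a * X b : MvPolynomial (Fin 5) ℂ).IsHomogeneous 2 := by
  refine IsHomogeneous.sum _ _ _ fun a _ => IsHomogeneous.sum _ _ _ fun b _ => ?_
  have h : ((C (U a b) : MvPolynomial (Fin 5) ℂ) * X a * X b).IsHomogeneous (0 + 1 + 1) :=
    ((isHomogeneous_C _ _).mul (isHomogeneous_X _ _)).mul (isHomogeneous_X _ _)
  simpa using h

/-- The cubic `Σ C(W a b c) X_a X_b X_c` is homogeneous of degree 3. [folklore] -/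
theorem cubic_isHomogeneous (W : Fin 5 → Fin 5 → Fin 5 → ℂ) :
    (∑ a : Fin 5, ∑ b : Fin 5, ∑ c : Fin 5, C (W a b c) * X a * X b * X c : MvPolynomial (Fin 5) ℂ).IsHomogeneous 3 := by
  refine IsHomogeneous.sum _ _ _ fun a _ => IsHomogeneous.sum _ _ _ fun b _ => IsHomogeneous.sum _ _ _ fun c _ => ?_
  have h : ((C (W a b c) : MvPolynomial (Fin 5) ℂ) * X a * X b * X c).IsHomogeneous (0 + 1 + 1 + 1) :=
    (((isHomogeneous_C _ _).mul (isHomogeneous_X _ _)).mul (isHomogeneous_X _ _)).mul (isHomogeneous_X _ _)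
  simpa using h

/-- Euler for the quadric: `Σ_i X_i ∂_i Q = 2·Q`. [folklore] -/
theorem euler_quadric (U : Fin 5 → Fin 5 → ℂ) :
    ∑ i : Fin 5, (X i : MvPolynomial (Fin 5) ℂ) * pderiv i (∑ a : Fin 5, ∑ b : Fin 5, C (U a b) * X a * X b)
      = 2 • (∑ a : Fin 5, ∑ b : Fin 5, C (U a b) * X a * X b : MvPolynomial (Fin 5) ℂ) := by
  simpa using (quadric_isHomogeneous U).sum_X_mul_pderiv

/-- Euler for the cubic: `Σ_i X_i ∂_i K = 3·K`. [folklore] -/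
theorem euler_cubic (W : Fin 5 → Fin 5 → Fin 5 → ℂ) :
    ∑ i : Fin 5, (X i : MvPolynomial (Fin 5) ℂ) *
        pderiv i (∑ a : Fin 5, ∑ b : Fin 5, ∑ c : Fin 5, C (W a b c) * X a * X b * X c)
      = 3 • (∑ a : Fin 5, ∑ b : Fin 5, ∑ c : Fin 5, C (W a b c) * X a * X b * X c : MvPolynomial (Fin 5) ℂ) := by
  simpa using (cubic_isHomogeneous W).sum_X_mul_pderiv

end LaplaceFiveStar

end Summit.ValiantsHypothesis.ValiantsHypothesis.Theorems.RigidityForcesSymmetryRankRigidMinimalRepr
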